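import Summits.ResolutionOfSingularities.ResolutionOfSingularities.Theorems.PurelyInseparableDim4ChartCentreClosed
import Summits.ResolutionOfSingularities.ResolutionOfSingularities.Theorems.PurelyInseparableDim4FirstStep
import Summits.ResolutionOfSingularities.ResolutionOfSingularities.Theorems.PurelyInseparableDim4CoordinateSNC
import Literature.AlgebraicGeometry.Resolution.AffineCoordinateBlowupLocal
import Literature.AlgebraicGeometry.Resolution.BlowupSNC
import HarnessLib

/-!
# Purely inseparable four-folds `z^p + F(x₁, …, x₄)`: the CHART CHAIN for coordinate centres — chart of a
# chart, and the two-step `IsMultipleBlowup` along `V(z, x_S)` then the globalised `V(z, x_{S'})`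
# (brick TY-2 (h) part 3 of cell `res-dim4-pi`)

[OURS · counted 0] (D-0157 DOOR 2; director-resolution DR-157-C; frame
`PIDim4.TerminationImpliesOrderReduction`, S3 (c); typ-3 memo §B (c4)/(c5)). Sequel of
`PurelyInseparableDim4ChartCentreClosed.lean`. For an open-immersion chart `φ : 𝔸⁵_K ⟶ Z` and a set of
coordinates `Λ'`, write `Z_c = 𝓘(closure φ(V(x_Λ')))` for the global centre of the previous file
(`φ^* Z_c = 𝓘Λ 4 K Λ'`). PROVED here (no `sorry`, no new axiom):

* §1 (any open immersion `φ`, any `Λ'`) `preimage_preimage_globalCentre` — the chart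
  `e = (φ.isoOpensRange)⁻¹ : φ(𝔸⁵) ≅ 𝔸⁵` carries `V(Z_c) ∩ φ(𝔸⁵)` onto `V(x_Λ')`;
  **`isBlowup_restrict_globalCentre`** — for ANY blowing up `π₂ : W₂ → Z` along `Z_c`, the restriction
  `(π₂ |_{φ(𝔸⁵)}) ≫ e` is a blowing up of `𝔸⁵_K` along `𝓘Λ 4 K Λ'` (tree
  `AffineCoordBlowup.isBlowup_restrict_comp_affineChartΛ`); `comap_transform_ideal_restrict_globalCentre` —
  the transformed marked ideal restricted over the chart is the controlled transform, under that blowing up,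
  of `φ^* M` (flat base change, BGMW §3.2 / Thm. 8.0.5);
* §2 **`transform_ideal_chart_of_chart`** — CHART OF A CHART: if `M` (multiplicity `p`) reads
  `(z^p + s₁.F)·𝒪` on `φ` and `p ≤ ord_{(x_{S'})} s₁.F`, then for every `j' ∈ S'` and every point `b'` of the
  new exceptional hyperplane (`b'_{j'} = 0`) there is a re-centring `Θ'` such that the transformed ideal reads
  `(z^p + (CentreBlowup.step p S' j' b' s₁).F)·𝒪` on the composite chart
  `Spec Θ' ≫ chartImm_{j'} ≫ (π₂⁻¹ φ(𝔸⁵) ↪ W₂)` (the dictionary `controlledTransform_chart_eq_step` one level up);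
* §3 **`isMultipleBlowup_extend_coord`** — the BGMW step along a globalised coordinate centre: from
  `IsMultipleBlowup M₀ σ M`, a chart `φ` on which `M` reads `(z^p + s₁.F)·𝒪`, `p ≤ ord_{(x_{S'})} s₁.F`,
  `IsClosed (φ(V(z, x_{S'})))`, `HasSNC M.boundary` and the snc of `φ^*(M.boundary)` with `V(z, x_{S'})`:
  `IsMultipleBlowup M₀ (π₂ ≫ σ) (M.transform π₂ Z_c)` for ANY blowing up `π₂` along `Z_c`;
* §4 **`depth_two`** — DEPTH TWO FOR COORDINATE CENTRES (the coordinate analogue of typ-3's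
  `exists_isMarkedResolution_depth_two` / `isMultipleBlowup_extend_point`): `K` perfect of characteristic
  `p`, `M₀ = (𝔸⁵, (z^p + F)·𝒪, [], p)`, `S` Hironaka-permissible for `F`, `π : W → 𝔸⁵` ANY blowing up along
  `V(z, x_S)`, `j ∈ S`, `b_j = 0`, `s₁ = CentreBlowup.step p S j b (F, 0, ∅)`, `S' ⊇ S ∖ {j}` Hironaka-permissible
  for `s₁.F`: there is a re-centred chart `φ = Spec Θ ≫ chartImm` on which `M₁ = M₀.transform π` reads
  `(z^p + s₁.F)·𝒪`, and for ANY blowing up `π₂ : W₂ → W` along the global centre `Z_c` of `V(z, x_{S'})`: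
  `IsMultipleBlowup M₀ (π₂ ≫ π) (M₁.transform π₂ Z_c)` (both steps admissible: regular centres inside the
  supports, snc with the boundaries `[]` and `[E]`), and on every chart of the chart the ideal reads
  `(z^p + (step p S' j' b' s₁).F)·𝒪`.

What is NOT here: the closedness of the chart centre at depth ≥ 3 (the accumulated fibre directions of ALL
earlier blow-ups enter; at depth 2 it is `S.erase j ⊆ S'`), the converse «centre escape» for `S.erase j ⊄ S'`,
and the boundary condition for positive-dimensional centres beyond depth 2 (the frame forgets boundary
components off the current point — desk caveat FC-1 «boundary amnesia», WORD #32 — so `HasSNCWith` stays a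
hypothesis of `isMultipleBlowup_extend_coord`). Nothing here is a statement about resolution of singularities
in dimension ≥ 4 / characteristic `p` (NOT proved anywhere in this programme). bears_on:
LADDER-RESOLUTION:D157-DOOR2 (res-dim4-pi). Supports stmt-ResolutionOfSingularities-16155 (helper, TY-2 (h)).
-/

-- every declaration of this summit lives under `Summit.ResolutionOfSingularities.ResolutionOfSingularities`
-- (summit = problem), which the duplicate-namespace linter flags; house convention (cf. the Target file).
set_option linter.dupNamespace false

noncomputable section

open MvPolynomial Finset CategoryTheory AlgebraicGeometry Opposite TopologicalSpace
open AlgebraicGeometry.Scheme.IdealSheafData (ofIdealTop vanishingIdeal)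

namespace Summit.ResolutionOfSingularities.ResolutionOfSingularities.Theorems.PIDim4

open Literature.AlgebraicGeometry.Resolution
open Literature.AlgebraicGeometry.Resolution.AffinePointBlowup (P A γ coord Wtop)

namespace ChartDictionary

/-! ## §1 The blow-up of the global centre, restricted over the chart -/

section Restrict

variable {K : Type} [Field K] {Z W₂ : Scheme.{0}} (φ : P 4 K ⟶ Z) [IsOpenImmersion φ] {π₂ : W₂ ⟶ Z}

/-- The chart `e = (φ.isoOpensRange)⁻¹ : φ(𝔸⁵) ≅ 𝔸⁵` carries `V(Z_c) ∩ φ(𝔸⁵)` — indeed the closed subset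
`closure φ(V(x_Λ'))` met with the chart — back onto `V(x_Λ')` (an open immersion is an embedding). -/
theorem preimage_preimage_globalCentre (Λ' : Set (Fin (4 + 1))) :
    ((closureImage φ ((AffineCoordBlowup.𝓘Λ 4 K Λ').support : Set (P 4 K))).preimage
        φ.opensRange.ι.continuous).preimage φ.isoOpensRange.symm.inv.base.hom.continuous =
      AffineCoordBlowup.CΛ 4 K Λ' := by
  have hD : (closureImage φ ((AffineCoordBlowup.𝓘Λ 4 K Λ').support : Set (P 4 K))).preimage φ.continuous =
      AffineCoordBlowup.CΛ 4 K Λ' := by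
    rw [preimage_closureImage_eq, AffineCoordBlowup.support_𝓘Λ]
  rw [← hD]
  apply Closeds.ext
  ext x
  change (φ.opensRange.ι).base ((φ.isoOpensRange.symm.inv).base x) ∈
      (closureImage φ ((AffineCoordBlowup.𝓘Λ 4 K Λ').support : Set (P 4 K)) : Set Z) ↔
    φ.base x ∈ (closureImage φ ((AffineCoordBlowup.𝓘Λ 4 K Λ').support : Set (P 4 K)) : Set Z)
  rw [Iso.symm_inv, ← Scheme.Hom.comp_apply, Scheme.Hom.isoOpensRange_hom_ι]

/-- **Over the chart, a blowing up of the global centre is a blowing up of `𝔸⁵_K` along `V(x_Λ')`**: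
`(π₂ |_{φ(𝔸⁵)}) ≫ e` is an `IsBlowup` along `𝓘Λ 4 K Λ'` (tree `AffineCoordBlowup.isBlowup_restrict_comp_affineChartΛ`,
Görtz–Wedhorn Prop. 13.91). No closedness hypothesis is needed. -/
theorem isBlowup_restrict_globalCentre (Λ' : Set (Fin (4 + 1)))
    (hπ₂ : IsBlowup π₂ (vanishingIdeal (closureImage φ ((AffineCoordBlowup.𝓘Λ 4 K Λ').support : Set (P 4 K))))) :
    IsBlowup ((π₂ ∣_ φ.opensRange) ≫ φ.isoOpensRange.symm.hom) (AffineCoordBlowup.𝓘Λ 4 K Λ') :=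
  AffineCoordBlowup.isBlowup_restrict_comp_affineChartΛ φ.isoOpensRange.symm
    (preimage_preimage_globalCentre φ Λ') hπ₂

/-- **The transformed marked ideal restricted over the chart** is the controlled transform, under the blowing up
`(π₂ |_{φ(𝔸⁵)}) ≫ e` of `𝔸⁵_K` along `𝓘Λ 4 K Λ'`, of `φ^* M` (controlled transforms commute with the flat base
change `π₂⁻¹ φ(𝔸⁵) ↪ W₂`, BGMW §3.2 with Thm. 8.0.5). -/
theorem comap_transform_ideal_restrict_globalCentre [IsLocallyNoetherian Z] (Λ' : Set (Fin (4 + 1))) (M : MarkedIdeal Z)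
    (hπ₂ : IsBlowup π₂ (vanishingIdeal (closureImage φ ((AffineCoordBlowup.𝓘Λ 4 K Λ').support : Set (P 4 K))))) :
    (M.transform π₂ (vanishingIdeal (closureImage φ
        ((AffineCoordBlowup.𝓘Λ 4 K Λ').support : Set (P 4 K))))).ideal.comap (π₂ ⁻¹ᵁ φ.opensRange).ι =
      controlledTransform ((π₂ ∣_ φ.opensRange) ≫ φ.isoOpensRange.symm.hom)
        (AffineCoordBlowup.𝓘Λ 4 K Λ') (M.ideal.comap φ) M.mult := by
  haveI : IsProper π₂ := hπ₂.isProper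
  haveI : IsLocallyNoetherian W₂ := LocallyOfFiniteType.isLocallyNoetherian π₂
  have hsq : (π₂ ⁻¹ᵁ φ.opensRange).ι ≫ π₂ = (π₂ ∣_ φ.opensRange) ≫ φ.opensRange.ι :=
    (morphismRestrict_ι π₂ φ.opensRange).symm
  rw [MarkedIdeal.transform_ideal, comap_controlledTransform_of_flat (t := φ.opensRange.ι) hsq]
  -- move the centre and the ideal across the chart isomorphism `e = isoOpensRange⁻¹`
  have hι : φ.isoOpensRange.inv ≫ φ = φ.opensRange.ι := by
    rw [Iso.inv_comp_eq, Scheme.Hom.isoOpensRange_hom_ι]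
  have key : ∀ I : Z.IdealSheafData, I.comap φ.opensRange.ι = (I.comap φ).comap φ.isoOpensRange.symm.hom := by
    intro I
    rw [Iso.symm_hom, ← Scheme.IdealSheafData.comap_comp, hι]
  rw [key, key, comap_globalCentre φ Λ', controlledTransform, controlledTransform,
    Scheme.IdealSheafData.comap_comp, Scheme.IdealSheafData.comap_comp]

end Restrict

/-! ## §2 Chart of a chart -/

section ChartOfChart

variable {K : Type} [Field K] {p : ℕ} [Fact p.Prime] [CharP K p] [PerfectRing K p] [DecidableEq K]
  {Z W₂ : Scheme.{0}} (φ : P 4 K ⟶ Z) [IsOpenImmersion φ] {π₂ : W₂ ⟶ Z}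

/-- **CHART OF A CHART.** Let `φ : 𝔸⁵_K ⟶ Z` be an open-immersion chart on which a marked ideal `M` of
multiplicity `p` reads `(z^p + s₁.F)·𝒪`, `S'` a coordinate centre with `p ≤ ord_{(x_{S'})} s₁.F`, and
`π₂ : W₂ → Z` ANY blowing up along the global centre `Z_c` of `V(z, x_{S'})`. Then for every chart index
`j' ∈ S'` and every point `b'` of the new exceptional hyperplane (`b'_{j'} = 0`) there is a re-centring
automorphism `Θ'` (`Θ' z = z + h'(x)`, `Θ' xᵢ = xᵢ + b'ᵢ`) such that along the composite open immersion
`Spec Θ' ≫ chartImm_{j'} ≫ (π₂⁻¹ φ(𝔸⁵) ↪ W₂)` the transformed ideal IS `(z^p + (CentreBlowup.step p S' j' b' s₁).F)·𝒪`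
— the tree's NEXT state again, one level up (`controlledTransform_chart_eq_step` for the blowing up
`(π₂ |_{φ(𝔸⁵)}) ≫ e` of `𝔸⁵`). -/
theorem transform_ideal_chart_of_chart [IsLocallyNoetherian Z] (M : MarkedIdeal Z) (hmult : M.mult = p)
    (s₁ : State K) (hM : M.ideal.comap φ = hypSheaf p s₁.F) {S' : Finset (Fin 4)}
    (hπ₂ : IsBlowup π₂ (vanishingIdeal (closureImage φ
      ((AffineCoordBlowup.𝓘Λ 4 K (insert 0 (Fin.succ '' (S' : Set (Fin 4))))).support : Set (P 4 K)))))
    {j' : Fin 4} (hj' : j' ∈ S') {b' : Fin 4 → K} (hbj' : b' j' = 0)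
    (hperm' : (p : ℕ∞) ≤ CentreBlowup.ordAlong S' s₁.F) :
    ∃ (Θ' : A 4 K ≃ₐ[K] A 4 K) (h' : MvPolynomial (Fin 4) K),
      Θ' (X 0) = X 0 + rename Fin.succ h' ∧ (∀ i : Fin 4, Θ' (X i.succ) = X i.succ + C (b' i)) ∧
      (M.transform π₂ (vanishingIdeal (closureImage φ
        ((AffineCoordBlowup.𝓘Λ 4 K (insert 0 (Fin.succ '' (S' : Set (Fin 4))))).support : Set (P 4 K))))).ideal.comap
        (Spec.map (CommRingCat.ofHom (Θ' : A 4 K →+* A 4 K)) ≫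
          AffineCoordBlowup.chartImm (isBlowup_restrict_globalCentre φ _ hπ₂) (succ_mem_centreVars hj') ≫
            (π₂ ⁻¹ᵁ φ.opensRange).ι) =
      hypSheaf p (CentreBlowup.step p S' j' b' s₁).F := by
  obtain ⟨Θ', h', h0', hs', hc⟩ :=
    controlledTransform_chart_eq_step p hj' hbj' s₁ hperm' (isBlowup_restrict_globalCentre φ _ hπ₂)
  refine ⟨Θ', h', h0', hs', ?_⟩
  rw [Scheme.IdealSheafData.comap_comp, Scheme.IdealSheafData.comap_comp,
    comap_transform_ideal_restrict_globalCentre φ _ M hπ₂, hmult, hM, ← Scheme.IdealSheafData.comap_comp]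
  exact hc

end ChartOfChart

/-! ## §3 The BGMW step along a globalised coordinate centre -/

section Extend

variable {K : Type} [Field K] {X₀ Z W₂ : Scheme.{0}} (φ : P 4 K ⟶ Z) [IsOpenImmersion φ] {π₂ : W₂ ⟶ Z}

/-- **One more admissible blow-up, along the global centre of a coordinate centre read in a chart.** From a
multiple blow-up `M₀ ⇝ M` (`IsMultipleBlowup M₀ σ M`, `M` on `Z`), an open-immersion chart `φ : 𝔸⁵_K ⟶ Z` on
which `M` (multiplicity `p`) reads `(z^p + F')·𝒪`, a coordinate centre `S'` with `p ≤ ord_{(x_{S'})} F'` whose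
image `φ(V(z, x_{S'}))` is CLOSED in `Z`, `HasSNC M.boundary`, and the snc of `φ^*(M.boundary)` with `V(z, x_{S'})`
on the chart: ANY blowing up `π₂ : W₂ → Z` along the global centre `Z_c` is admissible (BGMW Def. 3.1.3
(1)–(5)): `IsMultipleBlowup M₀ (π₂ ≫ σ) (M.transform π₂ Z_c)`. The snc hypothesis is NOT derivable from the cell's
presented state in general (boundary components off the current point — desk caveat FC-1). -/
theorem isMultipleBlowup_extend_coord [IsLocallyNoetherian Z] {M₀ : MarkedIdeal X₀} {σ : Z ⟶ X₀}
    {M : MarkedIdeal Z} (hσ : IsMultipleBlowup M₀ σ M) {p : ℕ} (hmult : M.mult = p)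
    {F' : MvPolynomial (Fin 4) K} (hM : M.ideal.comap φ = hypSheaf p F') {S' : Finset (Fin 4)}
    (hperm' : (p : ℕ∞) ≤ CentreBlowup.ordAlong S' F')
    (hT : IsClosed (φ '' (AffineCoordBlowup.CΛ 4 K (insert 0 (Fin.succ '' (S' : Set (Fin 4)))) : Set (P 4 K))))
    (hE : HasSNC M.boundary)
    (hEc : HasSNCWith (M.boundary.map (·.comap φ))
      (AffineCoordBlowup.𝓘Λ 4 K (insert 0 (Fin.succ '' (S' : Set (Fin 4))))))
    (hπ₂ : IsBlowup π₂ (vanishingIdeal (closureImage φ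
      ((AffineCoordBlowup.𝓘Λ 4 K (insert 0 (Fin.succ '' (S' : Set (Fin 4))))).support : Set (P 4 K))))) :
    IsMultipleBlowup M₀ (π₂ ≫ σ) (M.transform π₂ (vanishingIdeal (closureImage φ
      ((AffineCoordBlowup.𝓘Λ 4 K (insert 0 (Fin.succ '' (S' : Set (Fin 4))))).support : Set (P 4 K))))) :=
  IsMultipleBlowup.blowup hσ _ π₂ hπ₂ (isRegular_globalCentre φ hT)
    (support_globalCentre_subset_support φ hT hmult hM hperm') (hasSNCWith_globalCentre φ hT hE hEc)

end Extend

/-! ## §4 Depth two for coordinate centres -/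

section DepthTwo

variable {K : Type} [Field K] {p : ℕ} [Fact p.Prime] [CharP K p] [PerfectRing K p] [DecidableEq K]
  {S S' : Finset (Fin 4)} {j : Fin 4} {b : Fin 4 → K} {F : MvPolynomial (Fin 4) K} {W : Scheme.{0}} {π : W ⟶ P 4 K}

omit [Fact p.Prime] [CharP K p] [PerfectRing K p] [DecidableEq K] in
/-- The boundary of the first transform, read on a re-centred `x_j`-chart, is the single hyperplane `V(x_j)`,
which has simple normal crossings with every coordinate centre `V(x_Λ')` (`hasSNCWith_coordHyperplanes_𝓘Λ`). -/
theorem hasSNCWith_boundary_transform_chart (q : ℕ) (hj : j ∈ S) {Θ : A 4 K →+* A 4 K} (hΘ : Θ (X j.succ) = X j.succ)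
    (hπ : IsBlowup π (AffineCoordBlowup.𝓘Λ 4 K (insert 0 (Fin.succ '' (S : Set (Fin 4)))))) (Λ' : Set (Fin (4 + 1))) :
    HasSNCWith ((((⟨hypSheaf q F, [], q⟩ : MarkedIdeal (P 4 K)).transform π
        (AffineCoordBlowup.𝓘Λ 4 K (insert 0 (Fin.succ '' (S : Set (Fin 4)))))).boundary).map
        (·.comap (Spec.map (CommRingCat.ofHom Θ) ≫ AffineCoordBlowup.chartImm hπ (succ_mem_centreVars hj))))
      (AffineCoordBlowup.𝓘Λ 4 K Λ') := by
  have h := hasSNCWith_coordHyperplanes_𝓘Λ (n := 4) (K := K) [j.succ] Λ'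
  simp only [List.map_cons, List.map_nil] at h
  simp only [MarkedIdeal.transform_boundary, List.map_nil, List.nil_append, List.map_cons]
  rw [comap_exceptional_chart hj hΘ hπ]
  exact h

/-- **DEPTH TWO FOR COORDINATE CENTRES.** Let `K` be perfect of characteristic `p`, `M₀ = (𝔸⁵_K, (z^p + F)·𝒪, [], p)`,
`S` Hironaka-permissible for `z^p + F`, `π : W → 𝔸⁵_K` ANY blowing up along `V(z, x_S)` (`M₁` the transform),
`j ∈ S`, `b` a point of the exceptional hyperplane of the `x_j`-chart (`b_j = 0`), `s₁ = CentreBlowup.step p S j b (F, 0, ∅)`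
the walk's next state, and `S' ⊇ S ∖ {j}` a coordinate centre Hironaka-permissible for `z^p + s₁.F`. Then there is
a re-centred chart `φ = Spec Θ ≫ chartImm` (`Θ z = z + h(x)`, `Θ xᵢ = xᵢ + bᵢ`) on which `M₁` reads `(z^p + s₁.F)·𝒪`,
such that for ANY blowing up `π₂ : W₂ → W` along the global centre `Z_c = 𝓘(closure φ(V(z, x_{S'})))`:
(i) `IsMultipleBlowup M₀ (π₂ ≫ π) (M₁.transform π₂ Z_c)` — two admissible steps in the sense of BGMW Def. 3.1.3;
(ii) for every `j' ∈ S'`, `b'` with `b'_{j'} = 0`, on the chart of the chart the ideal of `M₁.transform π₂ Z_c` reads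
`(z^p + (CentreBlowup.step p S' j' b' s₁).F)·𝒪` — the walk's state after two edges. -/
theorem depth_two (hS : IsPermissibleCentre p S F)
    (hπ : IsBlowup π (AffineCoordBlowup.𝓘Λ 4 K (insert 0 (Fin.succ '' (S : Set (Fin 4)))))) (hj : j ∈ S)
    (hbj : b j = 0) (hS' : S.erase j ⊆ S')
    (hperm' : (p : ℕ∞) ≤ CentreBlowup.ordAlong S' (CentreBlowup.step p S j b (⟨F, 0, ∅⟩ : State K)).F) :
    ∃ (Θ : A 4 K ≃ₐ[K] A 4 K) (h : MvPolynomial (Fin 4) K),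
      haveI : IsIso (CommRingCat.ofHom (Θ : A 4 K →+* A 4 K)) :=
        (inferInstance : IsIso Θ.toRingEquiv.toCommRingCatIso.hom)
      Θ (X 0) = X 0 + rename Fin.succ h ∧ (∀ i : Fin 4, Θ (X i.succ) = X i.succ + C (b i)) ∧
      (((⟨hypSheaf p F, [], p⟩ : MarkedIdeal (P 4 K)).transform π
          (AffineCoordBlowup.𝓘Λ 4 K (insert 0 (Fin.succ '' (S : Set (Fin 4)))))).ideal).comap
        (Spec.map (CommRingCat.ofHom (Θ : A 4 K →+* A 4 K)) ≫ AffineCoordBlowup.chartImm hπ (succ_mem_centreVars hj)) =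
        hypSheaf p (CentreBlowup.step p S j b (⟨F, 0, ∅⟩ : State K)).F ∧
      ∀ (W₂ : Scheme.{0}) (π₂ : W₂ ⟶ W)
        (hπ₂ : IsBlowup π₂ (vanishingIdeal (closureImage
          (Spec.map (CommRingCat.ofHom (Θ : A 4 K →+* A 4 K)) ≫ AffineCoordBlowup.chartImm hπ (succ_mem_centreVars hj))
          ((AffineCoordBlowup.𝓘Λ 4 K (insert 0 (Fin.succ '' (S' : Set (Fin 4))))).support : Set (P 4 K))))),
        IsMultipleBlowup (⟨hypSheaf p F, [], p⟩ : MarkedIdeal (P 4 K)) (π₂ ≫ π)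
          ((((⟨hypSheaf p F, [], p⟩ : MarkedIdeal (P 4 K)).transform π
            (AffineCoordBlowup.𝓘Λ 4 K (insert 0 (Fin.succ '' (S : Set (Fin 4)))))).transform π₂
            (vanishingIdeal (closureImage
              (Spec.map (CommRingCat.ofHom (Θ : A 4 K →+* A 4 K)) ≫ AffineCoordBlowup.chartImm hπ (succ_mem_centreVars hj))
              ((AffineCoordBlowup.𝓘Λ 4 K (insert 0 (Fin.succ '' (S' : Set (Fin 4))))).support : Set (P 4 K)))))) ∧
        ∀ (j' : Fin 4) (hj' : j' ∈ S') (b' : Fin 4 → K), b' j' = 0 →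
          ∃ (Θ' : A 4 K ≃ₐ[K] A 4 K) (h' : MvPolynomial (Fin 4) K),
            Θ' (X 0) = X 0 + rename Fin.succ h' ∧ (∀ i : Fin 4, Θ' (X i.succ) = X i.succ + C (b' i)) ∧
            ((((⟨hypSheaf p F, [], p⟩ : MarkedIdeal (P 4 K)).transform π
              (AffineCoordBlowup.𝓘Λ 4 K (insert 0 (Fin.succ '' (S : Set (Fin 4)))))).transform π₂
              (vanishingIdeal (closureImage
                (Spec.map (CommRingCat.ofHom (Θ : A 4 K →+* A 4 K)) ≫ AffineCoordBlowup.chartImm hπ (succ_mem_centreVars hj))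
                ((AffineCoordBlowup.𝓘Λ 4 K (insert 0 (Fin.succ '' (S' : Set (Fin 4))))).support : Set (P 4 K))))).ideal).comap
              (Spec.map (CommRingCat.ofHom (Θ' : A 4 K →+* A 4 K)) ≫
                AffineCoordBlowup.chartImm (isBlowup_restrict_globalCentre _ _ hπ₂) (succ_mem_centreVars hj') ≫
                  (π₂ ⁻¹ᵁ (Spec.map (CommRingCat.ofHom (Θ : A 4 K →+* A 4 K)) ≫
                    AffineCoordBlowup.chartImm hπ (succ_mem_centreVars hj)).opensRange).ι) =
            hypSheaf p (CentreBlowup.step p S' j' b' (CentreBlowup.step p S j b (⟨F, 0, ∅⟩ : State K))).F := by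
  haveI : IsProper π := hπ.isProper
  haveI : IsLocallyNoetherian W := LocallyOfFiniteType.isLocallyNoetherian π
  obtain ⟨Θ, h, h0, hs, hI⟩ :=
    transform_ideal_chart_eq_step p hj hbj (⟨F, 0, ∅⟩ : State K) hS.2 [] hπ
  haveI : IsIso (CommRingCat.ofHom (Θ : A 4 K →+* A 4 K)) :=
    (inferInstance : IsIso Θ.toRingEquiv.toCommRingCatIso.hom)
  have hΘj : (Θ : A 4 K →+* A 4 K) (X j.succ) = X j.succ := by
    rw [show (Θ : A 4 K →+* A 4 K) (X j.succ) = Θ (X j.succ) from rfl, hs j, hbj, C_0, add_zero]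
  have hT := isClosed_image_CΛ_chart hj hbj h0 hs hπ hS'
  refine ⟨Θ, h, h0, hs, hI, fun W₂ π₂ hπ₂ => ⟨?_, fun j' hj' b' hbj' => ?_⟩⟩
  · exact isMultipleBlowup_extend_coord _ (isMultipleBlowup_single_of_isPermissibleCentre p hS hπ)
      (MarkedIdeal.transform_mult _ _ _) hI hperm' hT
      (MarkedIdeal.hasSNC_transform_boundary _ (hasSNCWith_nil_𝓘Λ _) hπ)
      (hasSNCWith_boundary_transform_chart p hj hΘj hπ _) hπ₂
  · exact transform_ideal_chart_of_chart _ _ (MarkedIdeal.transform_mult _ _ _) _ hI hπ₂ hj' hbj' hperm'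

end DepthTwo

end ChartDictionary

end Summit.ResolutionOfSingularities.ResolutionOfSingularities.Theorems.PIDim4

end
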